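import Summits.AtomisticToContinuum.HydrodynamicLimit.Theorems.CollisionIsometryCLTAdaptedWeightCLTBHCoarseningGermanoPointwise

/-!
# Stub `stub_coarsening` (S6) of the line `block-h-dissipation-closure` for the crux `AdaptedWeightCLT`
(stmt-AtomisticToContinuum-14868, rev-12 TIME-LOCAL form; `--supports`), helper file: THE THREE BOUNDS OF THE
GERMANO SPLIT of one block moment (`Coarsening.blkC_eq_three` of the previous file, `blkC = J + e + T`)

* `sq_cellTerm_le` — the CELL TERM by Jensen against the unit-mass block kernel:
  `J² ≤ ∫ φ_N(x' − x) · blkC r ψ x' C² dx'`;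
* `sq_kvTerm_le` — the KERNEL-VARIATION error:
  `e² ≤ (ε_N c_p)² (N+1)⁻¹ Σᵢ 𝟙[d(xᵢ,x) < R_N] ∫ ψ_N(xᵢ − x') |vᵢ − ū_ψ(x')|^{2r} dx'`
  (`|p| ≤ c_p |y|^r`; Cauchy–Schwarz in `i` using only `(N+1)⁻¹ #{i} ≤ 1`, Jensen in `x'`);
* `sq_reyTerm_le` — the REYNOLDS terms: `T² ≤ 2(α² + β²) · ethG · reyG` whenever the test pairing obeys
  `|p(y + d) − p(y)| ≤ α F(y)|d| + β |d| G(d)` with `F² ≤ 1 + |y|² + |y|⁴`, `G² ≤ |d|² + |d|⁴` (AM–GM under the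
  integral sign, then `sq_le_mul_of_forall`).
-/

namespace Summit.AtomisticToContinuum.HydrodynamicLimit.Theorems.BlockHDissipation

open scoped BigOperators Topology Classical MeasureTheory ENNReal InnerProductSpace
open Filter Set MeasureTheory
open Literature.Analysis.FluidPDE Literature.Analysis.FluidPDE.Torus
open Summit.AtomisticToContinuum.HydrodynamicLimit.Theorems.ContactSourceDuhamel
open Summit.AtomisticToContinuum.HydrodynamicLimit.Theorems.ContactSourceDuhamel.TimeLocal
open Summit.AtomisticToContinuum.HydrodynamicLimit.Theorems.ContactBalance
open Literature.MathematicalPhysics.KineticTheory (hsDiameter localGibbsLaw empiricalDensityField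
  empiricalMomentumField)

noncomputable section

namespace Coarsening

section Integrable

variable {N : ℕ} {ψ : ℕ → T3 → ℝ}

/-- Integrability of a BLOCK AVERAGE OF CELL-SMEARED quantities: `x' ↦ (N+1)⁻¹ Σᵢ aᵢ ψ_N(xᵢ − x') Kᵢ(x', ū_ψ(x'))`
for jointly continuous `Kᵢ`. -/
theorem integrable_avg (hψc : Continuous (ψ N)) (hψ0 : ∀ y, 0 ≤ ψ N y) (w : Cfg N) (a : Fin (N + 1) → ℝ)
    {K : Fin (N + 1) → T3 → V3 → ℝ} (hK : ∀ i, Continuous (Function.uncurry (K i))) :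
    Integrable fun x' => ((N + 1 : ℕ) : ℝ)⁻¹ * ∑ i : Fin (N + 1),
      a i * (ψ N ((w i).1 - x') * K i x' (ubarC N ψ w x')) := by
  refine integrable_comp_ubarC hψc hψ0 w (H := fun x' z => ((N + 1 : ℕ) : ℝ)⁻¹ *
    ∑ i : Fin (N + 1), a i * (ψ N ((w i).1 - x') * K i x' z)) ?_
  fun_prop

/-- Integrability of ONE cell-smeared quantity: `x' ↦ ψ_N(xᵢ − x') K(x', ū_ψ(x'))`. -/
theorem integrable_wgt_mul (hψc : Continuous (ψ N)) (hψ0 : ∀ y, 0 ≤ ψ N y) (w : Cfg N) (i : Fin (N + 1))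
    {K : T3 → V3 → ℝ} (hK : Continuous (Function.uncurry K)) :
    Integrable fun x' => ψ N ((w i).1 - x') * K x' (ubarC N ψ w x') := by
  refine integrable_comp_ubarC hψc hψ0 w (H := fun x' z => ψ N ((w i).1 - x') * K x' z) ?_
  fun_prop

/-- Integrability of `x' ↦ k(x') · (blkC r ψ x' C)²` for continuous `k`. -/
theorem integrable_mul_blkC_sq (hψc : Continuous (ψ N)) (hψ0 : ∀ y, 0 ≤ ψ N y) (w : Cfg N) {k : T3 → ℝ}
    (hk : Continuous k) {r : ℕ} (Ct : Tens r) :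
    Integrable fun x' => k x' * blkC r N ψ w x' Ct ^ 2 := by
  have h : Integrable fun x' => k x' * (((N + 1 : ℕ) : ℝ)⁻¹ * ∑ i : Fin (N + 1),
      ψ N ((w i).1 - x') * pairT Ct (tpow r ((w i).2 - ubarC N ψ w x'))) ^ 2 :=
    integrable_comp_ubarC hψc hψ0 w (H := fun x' z => k x' * (((N + 1 : ℕ) : ℝ)⁻¹ *
      ∑ i : Fin (N + 1), ψ N ((w i).1 - x') * pairT Ct (tpow r ((w i).2 - z))) ^ 2) (by fun_prop)
  simpa only [blkC, wgtC] using h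

end Integrable

section Test

variable {N : ℕ} {γ C γc C' : ℝ} {φ ψ : ℕ → T3 → ℝ} {r : ℕ} (Ct : Tens r)

/-! ## The cell term -/

/-- **CELL TERM**: `(∫ φ_N(x' − x) blkC r ψ x' C dx')² ≤ ∫ φ_N(x' − x) (blkC r ψ x' C)² dx'` (Jensen against
the unit-mass nonnegative block kernel). -/
theorem sq_cellTerm_le (hadm : AdmissibleKernel γ C φ) (hadmc : AdmissibleKernel γc C' ψ) (w : Cfg N)
    (x : T3) :
    (∫ x', φ N (x' - x) * blkC r N ψ w x' Ct) ^ 2 ≤ ∫ x', φ N (x' - x) * blkC r N ψ w x' Ct ^ 2 := by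
  have hk1 : ∫ x', φ N (x' - x) = 1 := by rw [integral_sub_right_eq_self (φ N) x]; exact hadm.2.2.1 N
  have hφc : Continuous (φ N) := (hadm.1 N).continuous
  have hkc : Continuous fun x' => φ N (x' - x) := hφc.comp (continuous_id.sub continuous_const)
  exact sq_integral_mul_le (fun x' => hadm.2.1 N _) hk1
    (integrable_mul_blkC_sq (hadmc.1 N).continuous (hadmc.2.1 N) w hkc Ct)
    (PastDamping.integrable_of_continuous_T3 hkc)

/-! ## The kernel-variation error -/

/-- **KERNEL-VARIATION ERROR**: for a test with `|p(y)| ≤ c_p |y|^r`,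
`e² ≤ (ε_N c_p)² · (N+1)⁻¹ Σᵢ 𝟙[d(xᵢ, x) < R_N] ∫ ψ_N(xᵢ − x') |vᵢ − ū_ψ(x')|^{2r} dx'`. -/
theorem sq_kvTerm_le (hadm : AdmissibleKernel γ C φ) (hadmc : AdmissibleKernel γc C' ψ) (w : Cfg N)
    (x : T3) {cp : ℝ} (hp : ∀ y, |pairT Ct (tpow r y)| ≤ cp * ‖y‖ ^ r) :
    (∫ x', ((N + 1 : ℕ) : ℝ)⁻¹ * ∑ i : Fin (N + 1), (wgtC N φ w x i - φ N (x' - x)) *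
        (wgtC N ψ w x' i * pairT Ct (tpow r ((w i).2 - ubarC N ψ w x')))) ^ 2 ≤
      (kvLip γ C γc N * cp) ^ 2 * (((N + 1 : ℕ) : ℝ)⁻¹ * ∑ i : Fin (N + 1),
        (if euclidDist (w i).1 x < kvRad γ γc N then (1 : ℝ) else 0) *
          ∫ x', wgtC N ψ w x' i * ‖(w i).2 - ubarC N ψ w x'‖ ^ (2 * r)) := by
  have hψc : Continuous (ψ N) := (hadmc.1 N).continuous
  have hψ0 := hadmc.2.1 N
  have hε := kvLip_nonneg hadm γc N
  have hn : (0 : ℝ) ≤ ((N + 1 : ℕ) : ℝ)⁻¹ := by positivity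
  have hn1 : ((N + 1 : ℕ) : ℝ)⁻¹ * ∑ _i : Fin (N + 1), (1 : ℝ) = 1 := by
    rw [Finset.sum_const, Finset.card_univ, Fintype.card_fin, nsmul_eq_mul, mul_one,
      inv_mul_cancel₀ (by positivity)]
  set ε := kvLip γ C γc N with hε_def
  have h01 : ∀ i : Fin (N + 1), (0 : ℝ) ≤ (if euclidDist (w i).1 x < kvRad γ γc N then (1 : ℝ) else 0) ∧
      (if euclidDist (w i).1 x < kvRad γ γc N then (1 : ℝ) else 0) ≤ 1 := fun i => by
    split_ifs <;> norm_num
  -- the moments `mᵢ = ∫ bᵢ |yᵢ|^r`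
  set m : Fin (N + 1) → ℝ := fun i => ∫ x', wgtC N ψ w x' i * ‖(w i).2 - ubarC N ψ w x'‖ ^ r with hm_def
  have hIm : ∀ i, Integrable fun x' => wgtC N ψ w x' i * ‖(w i).2 - ubarC N ψ w x'‖ ^ r := fun i =>
    integrable_wgt_mul hψc hψ0 w i (K := fun _ z => ‖(w i).2 - z‖ ^ r) (by fun_prop)
  -- Step 1: `|e| ≤ ε c_p (N+1)⁻¹ Σᵢ 𝟙ᵢ mᵢ`
  have h1 : |∫ x', ((N + 1 : ℕ) : ℝ)⁻¹ * ∑ i : Fin (N + 1), (wgtC N φ w x i - φ N (x' - x)) *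
      (wgtC N ψ w x' i * pairT Ct (tpow r ((w i).2 - ubarC N ψ w x')))| ≤
      ε * cp * (((N + 1 : ℕ) : ℝ)⁻¹ * ∑ i : Fin (N + 1),
        (if euclidDist (w i).1 x < kvRad γ γc N then (1 : ℝ) else 0) * m i) := by
    have hg : Integrable fun x' => ((N + 1 : ℕ) : ℝ)⁻¹ * ∑ i : Fin (N + 1),
        (ε * cp * (if euclidDist (w i).1 x < kvRad γ γc N then (1 : ℝ) else 0)) *
          (wgtC N ψ w x' i * ‖(w i).2 - ubarC N ψ w x'‖ ^ r) :=
      integrable_avg hψc hψ0 w _ (K := fun i _ z => ‖(w i).2 - z‖ ^ r) fun i => by fun_prop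
    calc |∫ x', ((N + 1 : ℕ) : ℝ)⁻¹ * ∑ i : Fin (N + 1), (wgtC N φ w x i - φ N (x' - x)) *
          (wgtC N ψ w x' i * pairT Ct (tpow r ((w i).2 - ubarC N ψ w x')))|
        = ‖∫ x', ((N + 1 : ℕ) : ℝ)⁻¹ * ∑ i : Fin (N + 1), (wgtC N φ w x i - φ N (x' - x)) *
          (wgtC N ψ w x' i * pairT Ct (tpow r ((w i).2 - ubarC N ψ w x')))‖ := (Real.norm_eq_abs _).symm
      _ ≤ ∫ x', ((N + 1 : ℕ) : ℝ)⁻¹ * ∑ i : Fin (N + 1),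
          (ε * cp * (if euclidDist (w i).1 x < kvRad γ γc N then (1 : ℝ) else 0)) *
            (wgtC N ψ w x' i * ‖(w i).2 - ubarC N ψ w x'‖ ^ r) := by
          refine norm_integral_le_of_norm_le hg (ae_of_all _ fun x' => ?_)
          rw [Real.norm_eq_abs, abs_mul, abs_of_nonneg hn]
          refine mul_le_mul_of_nonneg_left ((Finset.abs_sum_le_sum_abs _ _).trans
            (Finset.sum_le_sum fun i _ => ?_)) hn
          have hkey := abs_wgtC_sub_mul_le hadm hadmc w x x' i
          rw [abs_mul, abs_mul, abs_of_nonneg (show (0 : ℝ) ≤ wgtC N ψ w x' i from hψ0 _), ← mul_assoc]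
          calc |wgtC N φ w x i - φ N (x' - x)| * wgtC N ψ w x' i * |pairT Ct (tpow r ((w i).2 - ubarC N ψ w x'))|
              ≤ ε * (if euclidDist (w i).1 x < kvRad γ γc N then (1 : ℝ) else 0) * wgtC N ψ w x' i *
                  (cp * ‖(w i).2 - ubarC N ψ w x'‖ ^ r) :=
                mul_le_mul hkey (hp _) (abs_nonneg _) (mul_nonneg (mul_nonneg hε (h01 i).1) (hψ0 _))
            _ = _ := by ring
      _ = ε * cp * (((N + 1 : ℕ) : ℝ)⁻¹ * ∑ i : Fin (N + 1),
          (if euclidDist (w i).1 x < kvRad γ γc N then (1 : ℝ) else 0) * m i) := by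
          rw [integral_const_mul, integral_finsetSum _ fun i _ => (hIm i).const_mul _]
          simp only [integral_const_mul, hm_def, Finset.mul_sum]
          exact Finset.sum_congr rfl fun i _ => by ring
  -- Step 2: Cauchy–Schwarz in `i` with `(N+1)⁻¹ Σ 𝟙 ≤ 1`
  have h2 : (((N + 1 : ℕ) : ℝ)⁻¹ * ∑ i : Fin (N + 1),
      (if euclidDist (w i).1 x < kvRad γ γc N then (1 : ℝ) else 0) * m i) ^ 2 ≤
      ((N + 1 : ℕ) : ℝ)⁻¹ * ∑ i : Fin (N + 1),
        (if euclidDist (w i).1 x < kvRad γ γc N then (1 : ℝ) else 0) * m i ^ 2 := by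
    rw [Finset.mul_sum, Finset.mul_sum]
    have hcs := Finset.sum_sq_le_sum_mul_sum_of_sq_le_mul Finset.univ
      (f := fun i => ((N + 1 : ℕ) : ℝ)⁻¹ * (if euclidDist (w i).1 x < kvRad γ γc N then (1 : ℝ) else 0))
      (g := fun i => ((N + 1 : ℕ) : ℝ)⁻¹ * ((if euclidDist (w i).1 x < kvRad γ γc N then (1 : ℝ) else 0) * m i ^ 2))
      (r := fun i => ((N + 1 : ℕ) : ℝ)⁻¹ * ((if euclidDist (w i).1 x < kvRad γ γc N then (1 : ℝ) else 0) * m i))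
      (fun i _ => mul_nonneg hn (h01 i).1)
      (fun i _ => mul_nonneg hn (mul_nonneg (h01 i).1 (sq_nonneg _))) (fun i _ => le_of_eq (by ring))
    refine hcs.trans ?_
    have hle : ∑ i : Fin (N + 1), ((N + 1 : ℕ) : ℝ)⁻¹ *
        (if euclidDist (w i).1 x < kvRad γ γc N then (1 : ℝ) else 0) ≤ 1 :=
      calc _ ≤ ∑ _i : Fin (N + 1), ((N + 1 : ℕ) : ℝ)⁻¹ * (1 : ℝ) :=
            Finset.sum_le_sum fun i _ => mul_le_mul_of_nonneg_left (h01 i).2 hn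
        _ = 1 := by rw [← Finset.mul_sum, hn1]
    have hS : 0 ≤ ∑ i : Fin (N + 1), ((N + 1 : ℕ) : ℝ)⁻¹ *
        ((if euclidDist (w i).1 x < kvRad γ γc N then (1 : ℝ) else 0) * m i ^ 2) :=
      Finset.sum_nonneg fun i _ => mul_nonneg hn (mul_nonneg (h01 i).1 (sq_nonneg _))
    calc _ ≤ 1 * ∑ i : Fin (N + 1), ((N + 1 : ℕ) : ℝ)⁻¹ *
          ((if euclidDist (w i).1 x < kvRad γ γc N then (1 : ℝ) else 0) * m i ^ 2) :=
          mul_le_mul_of_nonneg_right hle hS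
      _ = _ := one_mul _
  -- Step 3: Jensen in `x'`: `mᵢ² ≤ ∫ bᵢ |yᵢ|^{2r}`
  have h3 : ∀ i, m i ^ 2 ≤ ∫ x', wgtC N ψ w x' i * ‖(w i).2 - ubarC N ψ w x'‖ ^ (2 * r) := fun i => by
    have e : ∀ x', wgtC N ψ w x' i * ‖(w i).2 - ubarC N ψ w x'‖ ^ (2 * r) =
        wgtC N ψ w x' i * (‖(w i).2 - ubarC N ψ w x'‖ ^ r) ^ 2 := fun x' => by ring
    simp_rw [e]
    exact sq_integral_mul_le (fun x' => hψ0 _) (integral_wgtC_right (hadmc.2.2.1 N) w i)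
      (integrable_wgt_mul hψc hψ0 w i (K := fun _ z => (‖(w i).2 - z‖ ^ r) ^ 2) (by fun_prop))
      (PastDamping.integrable_of_continuous_T3 (hψc.comp (continuous_const.sub continuous_id)))
  -- assemble
  have hS0 : 0 ≤ ((N + 1 : ℕ) : ℝ)⁻¹ * ∑ i : Fin (N + 1),
      (if euclidDist (w i).1 x < kvRad γ γc N then (1 : ℝ) else 0) * m i :=
    mul_nonneg hn (Finset.sum_nonneg fun i _ => mul_nonneg (h01 i).1 (integral_nonneg fun x' =>
      mul_nonneg (hψ0 _) (pow_nonneg (norm_nonneg _) _)))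
  calc _ ≤ (ε * cp * (((N + 1 : ℕ) : ℝ)⁻¹ * ∑ i : Fin (N + 1),
        (if euclidDist (w i).1 x < kvRad γ γc N then (1 : ℝ) else 0) * m i)) ^ 2 := by
        rw [← sq_abs]
        exact pow_le_pow_left₀ (abs_nonneg _) h1 2
    _ = (ε * cp) ^ 2 * (((N + 1 : ℕ) : ℝ)⁻¹ * ∑ i : Fin (N + 1),
        (if euclidDist (w i).1 x < kvRad γ γc N then (1 : ℝ) else 0) * m i) ^ 2 := by ring
    _ ≤ (ε * cp) ^ 2 * (((N + 1 : ℕ) : ℝ)⁻¹ * ∑ i : Fin (N + 1),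
        (if euclidDist (w i).1 x < kvRad γ γc N then (1 : ℝ) else 0) * m i ^ 2) :=
        mul_le_mul_of_nonneg_left h2 (sq_nonneg _)
    _ ≤ _ := by
        refine mul_le_mul_of_nonneg_left (mul_le_mul_of_nonneg_left (Finset.sum_le_sum fun i _ => ?_) hn)
          (sq_nonneg _)
        exact mul_le_mul_of_nonneg_left (h3 i) (h01 i).1

/-! ## The Reynolds terms -/

/-- One AM–GM step under the integral: a mixed moment `M = ∫ (N+1)⁻¹ Σᵢ aᵢ bᵢ f g` with `f² ≤ E`-integrand and
`g² ≤ R`-integrand of `ethG`, `reyG` satisfies `M² ≤ ethG · reyG`. -/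
theorem sq_mixed_le (hadm : AdmissibleKernel γ C φ) (hadmc : AdmissibleKernel γc C' ψ) (w : Cfg N) (x : T3)
    {f g : V3 → V3 → ℝ} (hf : Continuous (Function.uncurry f)) (hg : Continuous (Function.uncurry g))
    (hf0 : ∀ y z, 0 ≤ f y z) (hg0 : ∀ y z, 0 ≤ g y z)
    (hfsq : ∀ v z, f v z ^ 2 ≤ 1 + ‖v - z‖ ^ 2 + ‖v - z‖ ^ 4 + ‖z - ubarC N φ w x‖ ^ 2)
    (hgsq : ∀ v z, g v z ^ 2 ≤ ‖z - ubarC N φ w x‖ ^ 2 + ‖z - ubarC N φ w x‖ ^ 4) :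
    (∫ x', ((N + 1 : ℕ) : ℝ)⁻¹ * ∑ i : Fin (N + 1), wgtC N φ w x i *
        (wgtC N ψ w x' i * (f (w i).2 (ubarC N ψ w x') * g (w i).2 (ubarC N ψ w x')))) ^ 2 ≤
      ethG N φ ψ w x * reyG N φ ψ w x := by
  have hψc : Continuous (ψ N) := (hadmc.1 N).continuous
  have hψ0 := hadmc.2.1 N
  have hφ0 := hadm.2.1 N
  have hn : (0 : ℝ) ≤ ((N + 1 : ℕ) : ℝ)⁻¹ := by positivity
  have hIM : Integrable fun x' => ((N + 1 : ℕ) : ℝ)⁻¹ * ∑ i : Fin (N + 1), wgtC N φ w x i *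
      (wgtC N ψ w x' i * (f (w i).2 (ubarC N ψ w x') * g (w i).2 (ubarC N ψ w x'))) :=
    integrable_avg hψc hψ0 w _ (K := fun i _ z => f (w i).2 z * g (w i).2 z) fun i => by fun_prop
  have hIE : Integrable fun x' => ((N + 1 : ℕ) : ℝ)⁻¹ * ∑ i : Fin (N + 1), wgtC N φ w x i * (wgtC N ψ w x' i *
      (1 + ‖(w i).2 - ubarC N ψ w x'‖ ^ 2 + ‖(w i).2 - ubarC N ψ w x'‖ ^ 4 +
        ‖ubarC N ψ w x' - ubarC N φ w x‖ ^ 2)) :=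
    integrable_avg hψc hψ0 w _ (K := fun i _ z => 1 + ‖(w i).2 - z‖ ^ 2 + ‖(w i).2 - z‖ ^ 4 +
      ‖z - ubarC N φ w x‖ ^ 2) fun i => by fun_prop
  have hIR : Integrable fun x' => ((N + 1 : ℕ) : ℝ)⁻¹ * ∑ i : Fin (N + 1), wgtC N φ w x i * (wgtC N ψ w x' i *
      (‖ubarC N ψ w x' - ubarC N φ w x‖ ^ 2 + ‖ubarC N ψ w x' - ubarC N φ w x‖ ^ 4)) :=
    integrable_avg hψc hψ0 w _ (K := fun i _ z => ‖z - ubarC N φ w x‖ ^ 2 + ‖z - ubarC N φ w x‖ ^ 4)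
      fun i => by fun_prop
  have hM0 : 0 ≤ ∫ x', ((N + 1 : ℕ) : ℝ)⁻¹ * ∑ i : Fin (N + 1), wgtC N φ w x i *
      (wgtC N ψ w x' i * (f (w i).2 (ubarC N ψ w x') * g (w i).2 (ubarC N ψ w x'))) :=
    integral_nonneg fun x' => mul_nonneg hn (Finset.sum_nonneg fun i _ =>
      mul_nonneg (hφ0 _) (mul_nonneg (hψ0 _) (mul_nonneg (hf0 _ _) (hg0 _ _))))
  have hE0 : 0 ≤ ethG N φ ψ w x := integral_nonneg fun x' => mul_nonneg hn (Finset.sum_nonneg fun i _ =>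
    mul_nonneg (hφ0 _) (mul_nonneg (hψ0 _) (by positivity)))
  have hR0 : 0 ≤ reyG N φ ψ w x := integral_nonneg fun x' => mul_nonneg hn (Finset.sum_nonneg fun i _ =>
    mul_nonneg (hφ0 _) (mul_nonneg (hψ0 _) (by positivity)))
  refine sq_le_mul_of_forall hM0 hE0 hR0 fun t ht => ?_
  calc _ ≤ ∫ x', (t / 2 * (((N + 1 : ℕ) : ℝ)⁻¹ * ∑ i : Fin (N + 1), wgtC N φ w x i * (wgtC N ψ w x' i *
          (1 + ‖(w i).2 - ubarC N ψ w x'‖ ^ 2 + ‖(w i).2 - ubarC N ψ w x'‖ ^ 4 +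
            ‖ubarC N ψ w x' - ubarC N φ w x‖ ^ 2))) +
        t⁻¹ / 2 * (((N + 1 : ℕ) : ℝ)⁻¹ * ∑ i : Fin (N + 1), wgtC N φ w x i * (wgtC N ψ w x' i *
          (‖ubarC N ψ w x' - ubarC N φ w x‖ ^ 2 + ‖ubarC N ψ w x' - ubarC N φ w x‖ ^ 4)))) := by
        refine integral_mono hIM ((hIE.const_mul _).add (hIR.const_mul _)) fun x' => ?_
        simp only [Finset.mul_sum, ← Finset.sum_add_distrib]
        refine Finset.sum_le_sum fun i _ => ?_
        have ham := mul_le_amgm (hfsq (w i).2 (ubarC N ψ w x')) (hgsq (w i).2 (ubarC N ψ w x')) ht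
        have hab : 0 ≤ ((N + 1 : ℕ) : ℝ)⁻¹ * (wgtC N φ w x i * wgtC N ψ w x' i) :=
          mul_nonneg hn (mul_nonneg (hφ0 _) (hψ0 _))
        have := mul_le_mul_of_nonneg_left ham hab
        refine le_of_eq_of_le (by ring) (this.trans_eq (by ring))
    _ = t / 2 * ethG N φ ψ w x + t⁻¹ / 2 * reyG N φ ψ w x := by
        rw [integral_add (hIE.const_mul _) (hIR.const_mul _), integral_const_mul (t / 2),
          integral_const_mul (t⁻¹ / 2)]
        rfl

/-- **REYNOLDS TERMS**: if `|p(y + d) − p(y)| ≤ α F(y)|d| + β |d| G(d)` with `F² ≤ 1 + |y|² + |y|⁴`,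
`G² ≤ |d|² + |d|⁴` (`F, G ≥ 0` continuous), then `T² ≤ 2(α² + β²) ethG · reyG`. -/
theorem sq_reyTerm_le (hadm : AdmissibleKernel γ C φ) (hadmc : AdmissibleKernel γc C' ψ) (w : Cfg N)
    (x : T3) {α β : ℝ} {F G : V3 → ℝ} (hFc : Continuous F) (hGc : Continuous G)
    (hF0 : ∀ y, 0 ≤ F y) (hG0 : ∀ d, 0 ≤ G d) (hFsq : ∀ y, F y ^ 2 ≤ 1 + ‖y‖ ^ 2 + ‖y‖ ^ 4)
    (hGsq : ∀ d, G d ^ 2 ≤ ‖d‖ ^ 2 + ‖d‖ ^ 4)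
    (hpd : ∀ y d, |pairT Ct (tpow r (y + d)) - pairT Ct (tpow r y)| ≤ α * (F y * ‖d‖) + β * (‖d‖ * G d)) :
    (∫ x', ((N + 1 : ℕ) : ℝ)⁻¹ * ∑ i : Fin (N + 1), wgtC N φ w x i * (wgtC N ψ w x' i *
        (pairT Ct (tpow r ((w i).2 - ubarC N φ w x)) - pairT Ct (tpow r ((w i).2 - ubarC N ψ w x'))))) ^ 2 ≤
      2 * (α ^ 2 + β ^ 2) * (ethG N φ ψ w x * reyG N φ ψ w x) := by
  have hψc : Continuous (ψ N) := (hadmc.1 N).continuous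
  have hψ0 := hadmc.2.1 N
  have hφ0 := hadm.2.1 N
  have hn : (0 : ℝ) ≤ ((N + 1 : ℕ) : ℝ)⁻¹ := by positivity
  set u := ubarC N φ w x with hu
  -- the two mixed moments
  set M₁ := ∫ x', ((N + 1 : ℕ) : ℝ)⁻¹ * ∑ i : Fin (N + 1), wgtC N φ w x i *
    (wgtC N ψ w x' i * (F ((w i).2 - ubarC N ψ w x') * ‖ubarC N ψ w x' - u‖)) with hM₁
  set M₂ := ∫ x', ((N + 1 : ℕ) : ℝ)⁻¹ * ∑ i : Fin (N + 1), wgtC N φ w x i *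
    (wgtC N ψ w x' i * (‖ubarC N ψ w x' - u‖ * G (ubarC N ψ w x' - u))) with hM₂
  have hI₁ : Integrable fun x' => ((N + 1 : ℕ) : ℝ)⁻¹ * ∑ i : Fin (N + 1), wgtC N φ w x i *
      (wgtC N ψ w x' i * (F ((w i).2 - ubarC N ψ w x') * ‖ubarC N ψ w x' - u‖)) :=
    integrable_avg hψc hψ0 w _ (K := fun i _ z => F ((w i).2 - z) * ‖z - u‖) fun i => by fun_prop
  have hI₂ : Integrable fun x' => ((N + 1 : ℕ) : ℝ)⁻¹ * ∑ i : Fin (N + 1), wgtC N φ w x i *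
      (wgtC N ψ w x' i * (‖ubarC N ψ w x' - u‖ * G (ubarC N ψ w x' - u))) :=
    integrable_avg hψc hψ0 w _ (K := fun i _ z => ‖z - u‖ * G (z - u)) fun i => by fun_prop
  -- `|T| ≤ α M₁ + β M₂`
  have hT : |∫ x', ((N + 1 : ℕ) : ℝ)⁻¹ * ∑ i : Fin (N + 1), wgtC N φ w x i * (wgtC N ψ w x' i *
      (pairT Ct (tpow r ((w i).2 - u)) - pairT Ct (tpow r ((w i).2 - ubarC N ψ w x'))))| ≤
      α * M₁ + β * M₂ := by
    calc _ = ‖∫ x', ((N + 1 : ℕ) : ℝ)⁻¹ * ∑ i : Fin (N + 1), wgtC N φ w x i * (wgtC N ψ w x' i *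
          (pairT Ct (tpow r ((w i).2 - u)) - pairT Ct (tpow r ((w i).2 - ubarC N ψ w x'))))‖ :=
          (Real.norm_eq_abs _).symm
      _ ≤ ∫ x', (α * (((N + 1 : ℕ) : ℝ)⁻¹ * ∑ i : Fin (N + 1), wgtC N φ w x i *
            (wgtC N ψ w x' i * (F ((w i).2 - ubarC N ψ w x') * ‖ubarC N ψ w x' - u‖))) +
          β * (((N + 1 : ℕ) : ℝ)⁻¹ * ∑ i : Fin (N + 1), wgtC N φ w x i *
            (wgtC N ψ w x' i * (‖ubarC N ψ w x' - u‖ * G (ubarC N ψ w x' - u))))) := by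
          refine norm_integral_le_of_norm_le ((hI₁.const_mul α).add (hI₂.const_mul β))
            (ae_of_all _ fun x' => ?_)
          rw [Real.norm_eq_abs, Finset.mul_sum]
          simp only [Finset.mul_sum, ← Finset.sum_add_distrib]
          refine (Finset.abs_sum_le_sum_abs _ _).trans (Finset.sum_le_sum fun i _ => ?_)
          have hkey := hpd ((w i).2 - ubarC N ψ w x') (ubarC N ψ w x' - u)
          rw [sub_add_sub_cancel] at hkey
          rw [abs_mul, abs_of_nonneg hn, abs_mul, abs_of_nonneg (show (0 : ℝ) ≤ wgtC N φ w x i from hφ0 _),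
            abs_mul, abs_of_nonneg (show (0 : ℝ) ≤ wgtC N ψ w x' i from hψ0 _)]
          have hab : 0 ≤ ((N + 1 : ℕ) : ℝ)⁻¹ * (wgtC N φ w x i * wgtC N ψ w x' i) :=
            mul_nonneg hn (mul_nonneg (hφ0 _) (hψ0 _))
          have := mul_le_mul_of_nonneg_left hkey hab
          refine le_of_eq_of_le (by ring) (this.trans_eq (by ring))
      _ = α * M₁ + β * M₂ := by
          rw [integral_add (hI₁.const_mul α) (hI₂.const_mul β), integral_const_mul α, integral_const_mul β]
  -- `M₁² , M₂² ≤ ethG · reyG`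
  have h₁ : M₁ ^ 2 ≤ ethG N φ ψ w x * reyG N φ ψ w x :=
    sq_mixed_le hadm hadmc w x (f := fun v z => F (v - z)) (g := fun _ z => ‖z - u‖) (by fun_prop)
      (by fun_prop) (fun _ _ => hF0 _) (fun _ _ => norm_nonneg _)
      (fun v z => by nlinarith [hFsq (v - z), sq_nonneg ‖z - ubarC N φ w x‖])
      (fun v z => by nlinarith [sq_nonneg (‖z - ubarC N φ w x‖ ^ 2)])
  have h₂ : M₂ ^ 2 ≤ ethG N φ ψ w x * reyG N φ ψ w x :=
    sq_mixed_le hadm hadmc w x (f := fun _ z => ‖z - u‖) (g := fun _ z => G (z - u)) (by fun_prop)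
      (by fun_prop) (fun _ _ => norm_nonneg _) (fun _ _ => hG0 _)
      (fun v z => by nlinarith [sq_nonneg ‖v - z‖, sq_nonneg (‖v - z‖ ^ 2)])
      (fun _ z => hGsq (z - u))
  -- assemble
  have hX0 : 0 ≤ ethG N φ ψ w x * reyG N φ ψ w x := (sq_nonneg M₁).trans h₁
  calc _ ≤ (α * M₁ + β * M₂) ^ 2 := by
        rw [← sq_abs]
        exact pow_le_pow_left₀ (abs_nonneg _) hT 2
    _ ≤ 2 * (α ^ 2 * M₁ ^ 2) + 2 * (β ^ 2 * M₂ ^ 2) := by nlinarith [sq_nonneg (α * M₁ - β * M₂)]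
    _ ≤ 2 * (α ^ 2 * (ethG N φ ψ w x * reyG N φ ψ w x)) + 2 * (β ^ 2 * (ethG N φ ψ w x * reyG N φ ψ w x)) := by
        gcongr
    _ = 2 * (α ^ 2 + β ^ 2) * (ethG N φ ψ w x * reyG N φ ψ w x) := by ring

/-! ## The split, squared -/

/-- **THE GERMANO SPLIT, SQUARED**: for a test pairing with `|p| ≤ c_p |y|^r` and
`|p(y + d) − p(y)| ≤ α F(y)|d| + β |d| G(d)` (`F² ≤ 1 + |y|² + |y|⁴`, `G² ≤ |d|² + |d|⁴`),
`blkC² ≤ 4 ∫ φ_N(x' − x) blkC_ψ² dx' + 4 (ε_N c_p)² (N+1)⁻¹ Σᵢ 𝟙ᵢ ∫ ψ_N(xᵢ − x')|vᵢ − ū_ψ(x')|^{2r} dx'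
 + 4 (α² + β²) ethG · reyG`. -/
theorem blkC_sq_le (hadm : AdmissibleKernel γ C φ) (hadmc : AdmissibleKernel γc C' ψ) (w : Cfg N) (x : T3)
    {cp α β : ℝ} {F G : V3 → ℝ} (hp : ∀ y, |pairT Ct (tpow r y)| ≤ cp * ‖y‖ ^ r) (hFc : Continuous F)
    (hGc : Continuous G) (hF0 : ∀ y, 0 ≤ F y) (hG0 : ∀ d, 0 ≤ G d)
    (hFsq : ∀ y, F y ^ 2 ≤ 1 + ‖y‖ ^ 2 + ‖y‖ ^ 4) (hGsq : ∀ d, G d ^ 2 ≤ ‖d‖ ^ 2 + ‖d‖ ^ 4)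
    (hpd : ∀ y d, |pairT Ct (tpow r (y + d)) - pairT Ct (tpow r y)| ≤ α * (F y * ‖d‖) + β * (‖d‖ * G d)) :
    blkC r N φ w x Ct ^ 2 ≤ 4 * (∫ x', φ N (x' - x) * blkC r N ψ w x' Ct ^ 2) +
      4 * ((kvLip γ C γc N * cp) ^ 2 * (((N + 1 : ℕ) : ℝ)⁻¹ * ∑ i : Fin (N + 1),
        (if euclidDist (w i).1 x < kvRad γ γc N then (1 : ℝ) else 0) *
          ∫ x', wgtC N ψ w x' i * ‖(w i).2 - ubarC N ψ w x'‖ ^ (2 * r))) +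
      4 * (α ^ 2 + β ^ 2) * (ethG N φ ψ w x * reyG N φ ψ w x) := by
  have hJ := sq_cellTerm_le Ct hadm hadmc w x
  have he := sq_kvTerm_le Ct hadm hadmc w x hp
  have hT := sq_reyTerm_le Ct hadm hadmc w x hFc hGc hF0 hG0 hFsq hGsq hpd
  rw [blkC_eq_three Ct hadm hadmc w x]
  set J := ∫ x', φ N (x' - x) * blkC r N ψ w x' Ct with hJd
  set e := ∫ x', ((N + 1 : ℕ) : ℝ)⁻¹ * ∑ i : Fin (N + 1), (wgtC N φ w x i - φ N (x' - x)) *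
    (wgtC N ψ w x' i * pairT Ct (tpow r ((w i).2 - ubarC N ψ w x'))) with hed
  set T := ∫ x', ((N + 1 : ℕ) : ℝ)⁻¹ * ∑ i : Fin (N + 1), wgtC N φ w x i * (wgtC N ψ w x' i *
    (pairT Ct (tpow r ((w i).2 - ubarC N φ w x)) - pairT Ct (tpow r ((w i).2 - ubarC N ψ w x')))) with hTd
  -- `(J + e + T)² ≤ 4J² + 4e² + 2T²` (cf. `Literature.Analysis.FluidPDE.Carleman.add_three_sq_le'`)
  have h3 : (J + e + T) ^ 2 ≤ 4 * J ^ 2 + 4 * e ^ 2 + 2 * T ^ 2 := by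
    nlinarith [sq_nonneg (J - e), sq_nonneg (J + e - T)]
  simp only [mul_assoc] at he hT ⊢
  linarith

end Test

end Coarsening

/-- Registered anchor of this helper file (`--supports stmt-AtomisticToContinuum-14868`): the CELL TERM of the
Germano split by Jensen against the unit-mass block kernel (`Coarsening.sq_cellTerm_le`). -/
theorem bhCoarsening_germanoBounds_anchor : ∀ (N : ℕ) (γ C γc C' : ℝ) (φ ψ : ℕ → T3 → ℝ) (r : ℕ) (Ct : Tens r) (w : Cfg N) (x : T3), AdmissibleKernel γ C φ → AdmissibleKernel γc C' ψ → (∫ x', φ N (x' - x) * blkC r N ψ w x' Ct) ^ 2 ≤ ∫ x', φ N (x' - x) * blkC r N ψ w x' Ct ^ 2 :=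
  fun _ _ _ _ _ _ _ _ Ct w x hadm hadmc => Coarsening.sq_cellTerm_le Ct hadm hadmc w x

end

end Summit.AtomisticToContinuum.HydrodynamicLimit.Theorems.BlockHDissipation
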